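import Literature.MathematicalPhysics.QuantumFieldTheory.Balaban1983to89.B7Eq38Remainder

/-!
# Bałaban's renormalization group for 4-d lattice Yang–Mills — B7 §A (31): `|log e^X e^Y − X − Y| ≤ 2|X||Y|`
with an explicit admissible `c₁`, and (v1.1) (30): `|log e^X e^Y − X − Y − ½[X, Y]| ≤ 5(|X|²|Y| + |X||Y|²)`
(`B7Eq31BCH`)

CITATION HEADER (lean-in-tree rule 2026-08-18).  Audit cell `pub-balaban`, paper sub-cell B07 (unit b2b-balaban-b07,
gen 12).  Source: T. Bałaban, *Averaging operations for lattice gauge theories*, Commun. Math. Phys. **98**, 17–51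
(1985) [Balaban1985Averaging] (cell paper B7; journal page = PDF page + 16), §A p. 22 [PDF 6], quoted from the page
render `b2b-balaban-ref1/pages/1985-cmp98-averaging/1985-cmp98-averaging-p006-x2.png` READ AS AN IMAGE (text layer
`paper:balaban1985-cmp98-averaging` p0006 used for locating only).  Companion of `MatrixLog` ((21)–(27): `log` = the
series (21) `MatrixLog.mlog`), `B7BlockAvgLog` (`mlog_exp`: `log e^C = C` for `‖C‖ < ln 2`) and `B7Eq38Remainder`
((28), (36)–(41); its header lists (29)–(31) as NOT reproduced — this file supplies (31), and, from v1.1 on (§6),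
(30) with an explicit `O(1)`).  v1.1 is APPEND-ONLY: the 19 declarations of v1 (§§1–5) are unchanged; v1.2 is a
DOCSTRING-ONLY correction of one sentence of FINDINGS below (all 28 declarations of v1.1 unchanged).

THE PRINTED TEXT (p. 22).  "Let us define `Z(u, v) = log e^{uX}e^{vY}`. (28) … Its power series expansion is given by
the Baker-Campbell-Haussdorf formula (see [7], Sect. 2.15) `Z = log e^X e^Y = Σ_{m=1}^∞ Σ_{pᵢ+qᵢ≥1} ((−1)^{m+1}/m)
(p₁+…+p_m+q₁+…+q_m)^{−1} (p₁!q₁!…p_m!q_m!)^{−1} (ad_X)^{p₁}(ad_Y)^{q₁}…(ad_X)^{p_m}(ad_Y)^{q_m−1} Y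
= X + Y + ½[X, Y] + (1/12)[Y, [Y, X]] + (1/12)[X, [X, Y]] + …`, (29) where `ad_X Y = [X, Y] = XY − YX`, and the
series is convergent in a neighborhood of `0`: `|X|, |Y| ≤ c₀` for some positive `c₀`. From the structure of this power
series expansion, we get easily the bound `|Z − X − Y − ½[X, Y]| ≤ O(1)(|X|²|Y| + |X||Y|²)`, (30) and this implies
`|Z − X − Y| ≤ 2|X||Y|` for `|X|, |Y| ≤ c₁`, (31) where `c₁` is a sufficiently small positive constant, `c₁ ≤ c₀`."

WHAT THIS FILE PROVES (kernel; `𝔸` any complete normed `ℂ`-algebra, `log` = the series (21) = `MatrixLog.mlog`,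
`|·|` = the norm).
* **(31) with an explicit admissible constant**: `eq31_printed` — for `‖X‖ ≤ 1/10`, `‖Y‖ ≤ 1/10`,
  `‖log (e^X e^Y) − X − Y‖ ≤ 2‖X‖‖Y‖`; and `eq31_of_sum_le` — the same under the weaker `‖X‖ + ‖Y‖ ≤ 1/5`.  So
  `c₁ = 1/10` IS ADMISSIBLE in (31) (print: "a sufficiently small positive constant").
* The closed-form majorant behind it, valid on the whole polydisc `‖X‖ + ‖Y‖ < ln 2` where `log e^X e^Y` is given by the
  series (21) (`norm_bch_sub_le_of_norm_add_lt`): with `a = ‖X‖`, `b = ‖Y‖`,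
  `‖log (e^X e^Y) − X − Y‖ ≤ (e^a − 1)(e^b − 1)·e^{a+b}/(2 − e^{a+b})` (`= ab(1 + O(a + b))`: the leading constant is
  `1`, and the printed `2` is the room that absorbs `c₁ ≤ 1/10`), and its abstract forms: if `‖e^X − 1‖ ≤ P`,
  `‖e^Y − 1‖ ≤ Q`, `S := P + Q + PQ < 1` (and `‖X‖, ‖Y‖ < ln 2`, so that `log e^X = X`, `log e^Y = Y`), then
  `‖log (e^X e^Y) − X − Y‖ ≤ −ln(1 − S) + ln(1 − P) + ln(1 − Q) − PQ` (`norm_bch_sub_le_log`; the right side is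
  `ln(1 + 2PQ/(1 − S)) − PQ`) `≤ PQ(1 + S)/(1 − S)` (`norm_bch_sub_le`).
* **(30) with an explicit `O(1)`** (v1.1, §6): `eq30_printed` — for `‖X‖ ≤ 1/10`, `‖Y‖ ≤ 1/10`,
  `‖log (e^X e^Y) − X − Y − ½(XY − YX)‖ ≤ 5(‖X‖²‖Y‖ + ‖X‖‖Y‖²)`; `eq30_of_sum_le` — the same under `‖X‖ + ‖Y‖ ≤ 1/5`.
  So `O(1) = 5` IS ADMISSIBLE in (30) on `|X|, |Y| ≤ 1/10` (print: an unspecified `O(1)` on an unspecified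
  neighbourhood of `0`).  Behind it (`norm_bch_sub_comm_le_of_norm_add_lt`, on `a + b < ln 2`):
  `‖log (e^X e^Y) − X − Y − ½(XY − YX)‖ ≤ 2(e^a − 1)(e^b − 1)(e^{a+b} − 1)/(2 − e^{a+b}) + (a(e^b − 1 − b) +
  b(e^a − 1 − a) + (e^a − 1 − a)(e^b − 1 − b))` (`= (5/2)·ab(a + b)·(1 + O(a + b))`), with the abstract forms
  `norm_bch_sub_comm_le_log` / `norm_bch_sub_comm_le` (`≤ (−ln(1 − S) + ln(1 − P) + ln(1 − Q) − 2PQ) + (aσ + bρ + ρσ)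
  ≤ 2PQ·S/(1 − S) + (aσ + bρ + ρσ)` whenever also `‖e^X − 1 − X‖ ≤ ρ`, `‖e^Y − 1 − Y‖ ≤ σ`).

METHOD (elementary; NOT the route of the paper).  Print derives (31) from the BCH/Dynkin series (29) via (30).  The tree
has no BCH series (cell GAPS.md N-B7-1: "typable only with a matrix-BCH library"), and this file does not build one.
Instead, with `p = e^X − 1`, `q = e^Y − 1`, `e^X e^Y − 1 = p + q + pq`, three instances of the series (21) give
`log (e^X e^Y) − X − Y = Σ_{n≥1} ((−1)^{n+1}/n)·((p + q + pq)^n − p^n − q^n)` (`hasSum_bch_sub`; `log e^X = X` is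
`B7BlockAvgLog.mlog_exp`).  Every word of `(p + q + pq)^n − p^n − q^n` contains both `p` and `q`, and a word-by-word
majorant (`norm_mixedPow_le`, induction on `n`) gives `‖(p+q+pq)^n − p^n − q^n‖ ≤ S^n − P^n − Q^n`; the real majorant
series sums in closed form, `Σ_{n≥1} (S^n − P^n − Q^n)/n = −ln(1 − S) + ln(1 − P) + ln(1 − Q) = ln(1 + 2PQ/(1 − S))`
(`(1 − P)(1 − Q) = (1 − S) + 2PQ`).  The terms `n = 1, 2` are treated exactly (`lowOrder_eq`):
`pq − ½((p+q+pq)² − p² − q²) = ½(pq − qp) − ½(p²q + pqp + qpq + pq² + pqpq)`, whose norm is `PQ` LESS than its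
majorant — this commutator cancellation is what brings the constant down to the printed `2` (the plain majorant gives
`2PQ/(1 − S) > 2ab`).  The only numerical input is `e^{1/5} ≤ 11/9` (from `B7Eq38Remainder.exp_le_quartic`); the
elementary `e^t − 1 ≤ t e^t` is the tree's `AreaLaw.exp_sub_one_le_mul_exp` (`Sweep1AreaLawProofs`, in the import
closure via `B7Transfer`).  For (30) (§6, v1.1) the same split at `n = 3` is used, the words `n = 1, 2` minus `½[X, Y]`
being `½([p, q] − [X, Y]) − ½(p²q + pqp + qpq + pq² + pqpq)` (`lowOrder_sub_comm_eq`) with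
`[p, q] − [X, Y] = [X, s] + [r, Y] + [r, s]`, `r = e^X − 1 − X`, `s = e^Y − 1 − Y` (`comm_add_sub_comm`); the tail and
the cubic words together cost `−ln(1 − S) + ln(1 − P) + ln(1 − Q) − 2PQ ≤ 2PQ·S/(1 − S)`, and `‖r‖ ≤ e^a − 1 − a` is the
tree's `OneLinkLaplace.norm_exp_sub_one_sub_le` (module `TiltedExponentMorseBounds`, in the import closure via
`B7BlockAvgLog`); the final numerics use in addition only `|e^t − 1 − t| ≤ t²` for `|t| ≤ 1` (Mathlib
`Real.abs_exp_sub_one_sub_id_le`): with `E = e^{a+b} ≤ 11/9`, `2E²/(2 − E) ≤ 242/63` and `ab ≤ (a + b)/20`, so the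
bound is `≤ (242/63 + 21/20)·ab(a + b) < 4.9·(a²b + ab²)`.

WHAT IS NOT REPRODUCED.  (29) itself (the Dynkin form of the BCH series and its convergence radius `c₀`): as in
`B7Eq38Remainder`, scope item (ii) there, now narrowed to (29) alone (v1 of this file also left out (30); §6 of v1.1
proves it in the explicit form above — the printed `O(1)` and neighbourhood are unspecified, so what is certified is
ONE admissible pair, `O(1) = 5` on `|X|, |Y| ≤ 1/10`).  The derivation "from the structure of this power series
expansion" is not the tree's: both (30) and (31) are proved from the logarithmic series (21) directly on
`‖X‖ + ‖Y‖ < ln 2`, and the relation "`c₁ ≤ c₀`" is moot here (no reference to the convergence domain of (29)).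

FINDINGS OF THE AUDIT (cell GAPS.md C-b07g12-1; SMALLNESS census: the constant `c₁` of (31)).  (31) holds with the
printed constant `2` for `|X|, |Y| ≤ 1/10`, indeed for `|X| + |Y| ≤ 1/5` (kernel, this file).  The chain used here
(`e^a − 1 ≤ a e^a`, then `E²/(2 − E) ≤ 2` for `E = e^{a+b}`) yields the printed `2` exactly as long as
`E² + 2E − 4 ≤ 0`, i.e. `e^{a+b} ≤ √5 − 1`, `a + b ≤ ln(√5 − 1) = 0.2119…`; the kernel statement is cut at
`a + b ≤ 1/5` so that the only numerical input is the rational bound `e^{1/5} ≤ 11/9`.  Print: "`c₁` is a sufficiently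
small positive constant".  No objection.  (31) is invoked in print on p. 25 [PDF 9], proof of Proposition 1, between
(46) and (47) ("From this and (31) we get …"), at arguments `X = iΣ_{x∈B(c₋)} L^{−d}A(Γ_{c,x} ∪ (−c)) + O((L²α₀)²)`,
`Y = iA(c) + O((L²α₀)²)` of sizes `O(1)L²α₀` resp. `O(1)Lα₀` (same page: "`|V₀(Γ_{c,x}) − 1| < … = O(1)L²α₀`",
"`|A_b| < 2|b₋ − y|α₀ ≤ 2dLα₀`"), so that the (31)-error `2|X||Y|` is the displayed `O((L²α₀)²)`, "for `L²α₀`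
sufficiently small" (v1/v1.1 of this header said "arguments of size `O(1)(L²α₀)²`" — corrected in v1.2 after the
cross-read GAPS C-pv25g7-2, remark R1; no kernel content affected).
(30) (v1.1, §6; cell GAPS.md C-b07g12-2): holds with `O(1) = 5` on `|X|, |Y| ≤ 1/10`, indeed on `|X| + |Y| ≤ 1/5`
(kernel); for comparison, the third-order terms DISPLAYED in (29), `(1/12)[Y, [Y, X]] + (1/12)[X, [X, Y]]`, have norm
`≤ (1/3)(|X|²|Y| + |X||Y|²)`, so `5` is generous — it pays for the crude `‖r‖ ≤ a²` and for the whole tail at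
`a + b = 1/5` — but explicit.  Print: "`O(1)`".  No objection.
Value = kernel certificates of two printed inequalities with explicit admissible constants; NOT summit progress.
-/

noncomputable section

open NormedSpace
open scoped BigOperators

namespace Literature.MathematicalPhysics.QuantumFieldTheory.Balaban1983to89.B7Eq31BCH

open MatrixLog B7BlockAvgLog B7Eq38Remainder Finset
open Literature.Analysis.Complex (logOnePlus logSeriesCoeff logSeriesCoeff_zero)

/-! ## §1  The word majorant: every word of `(p + q + pq)^n − p^n − q^n` contains both letters -/

section Words

variable {𝔸 : Type*} [NormedRing 𝔸]

/-- The algebraic recursion behind the majorant: with `s = p + q + pq`,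
`s^{n+2} − p^{n+2} − q^{n+2} = s(s^{n+1} − p^{n+1} − q^{n+1}) + (q + pq)p^{n+1} + (p + pq)q^{n+1}`. [folklore] -/
theorem mixedPow_succ (p q : 𝔸) (n : ℕ) :
    (p + q + p * q) ^ (n + 2) - p ^ (n + 2) - q ^ (n + 2) =
      (p + q + p * q) * ((p + q + p * q) ^ (n + 1) - p ^ (n + 1) - q ^ (n + 1)) +
        (q + p * q) * p ^ (n + 1) + (p + p * q) * q ^ (n + 1) := by
  rw [pow_succ' (p + q + p * q) (n + 1), pow_succ' p (n + 1), pow_succ' q (n + 1)]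
  simp only [add_mul, mul_sub]
  abel

/-- **Word majorant.**  If `‖p‖ ≤ P`, `‖q‖ ≤ Q` then `‖(p + q + pq)^n − p^n − q^n‖ ≤ (P + Q + PQ)^n − P^n − Q^n`
(`n ≥ 1`): expanding, the left side is a signed-free sum of the words in `p, q` containing both letters, and the right
side is the same sum of the corresponding products of norms bounds. [folklore] -/
theorem norm_mixedPow_le {p q : 𝔸} {P Q : ℝ} (hp : ‖p‖ ≤ P) (hq : ‖q‖ ≤ Q) (n : ℕ) :
    ‖(p + q + p * q) ^ (n + 1) - p ^ (n + 1) - q ^ (n + 1)‖ ≤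
      (P + Q + P * Q) ^ (n + 1) - P ^ (n + 1) - Q ^ (n + 1) := by
  have hP : 0 ≤ P := (norm_nonneg p).trans hp
  have hpq : ‖p * q‖ ≤ P * Q := norm_mul_le_of_le hp hq
  have hs : ‖p + q + p * q‖ ≤ P + Q + P * Q := norm_add₃_le.trans (by linarith)
  induction n with
  | zero =>
    have h1 : (p + q + p * q) ^ (0 + 1) - p ^ (0 + 1) - q ^ (0 + 1) = p * q := by
      simp only [zero_add, pow_one]; abel
    rw [h1, show (P + Q + P * Q) ^ (0 + 1) - P ^ (0 + 1) - Q ^ (0 + 1) = P * Q by ring]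
    exact hpq
  | succ n ih =>
    have hpn : ‖p ^ (n + 1)‖ ≤ P ^ (n + 1) :=
      (norm_pow_le' p n.succ_pos).trans (pow_le_pow_left₀ (norm_nonneg _) hp _)
    have hqn : ‖q ^ (n + 1)‖ ≤ Q ^ (n + 1) :=
      (norm_pow_le' q n.succ_pos).trans (pow_le_pow_left₀ (norm_nonneg _) hq _)
    have h1 : ‖q + p * q‖ ≤ Q + P * Q := norm_add_le_of_le hq hpq
    have h2 : ‖p + p * q‖ ≤ P + P * Q := norm_add_le_of_le hp hpq
    rw [show n + 1 + 1 = n + 2 by ring, mixedPow_succ]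
    calc _ ≤ ‖(p + q + p * q) * ((p + q + p * q) ^ (n + 1) - p ^ (n + 1) - q ^ (n + 1))‖ +
          ‖(q + p * q) * p ^ (n + 1)‖ + ‖(p + p * q) * q ^ (n + 1)‖ := norm_add₃_le
      _ ≤ (P + Q + P * Q) * ((P + Q + P * Q) ^ (n + 1) - P ^ (n + 1) - Q ^ (n + 1)) +
          (Q + P * Q) * P ^ (n + 1) + (P + P * Q) * Q ^ (n + 1) :=
          add_le_add (add_le_add (norm_mul_le_of_le hs ih) (norm_mul_le_of_le h1 hpn)) (norm_mul_le_of_le h2 hqn)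
      _ = _ := by ring

/-- The expansion of the degree-2 mixed words: `(p + q + pq)² − p² − q² = pq + qp + (p²q + pqp + qpq + pq² + pqpq)`.
[folklore] -/
theorem mixedPow_two (p q : 𝔸) :
    (p + q + p * q) ^ 2 - p ^ 2 - q ^ 2 =
      p * q + q * p + (p * p * q + p * q * p + q * p * q + p * q * q + p * q * p * q) := by
  noncomm_ring

end Words

/-! ## §2  The terms `n = 1, 2` exactly: the commutator cancellation -/

section LowOrder

variable {𝔸 : Type*} [NormedRing 𝔸] [NormedAlgebra ℂ 𝔸]

/-- `logSeriesCoeff 2 = −1/2` (`logSeriesCoeff 1 = 1` is the tree's `MatrixLog`-companion fact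
`norm_logSeriesCoeff_succ 0`, used below in the form `‖logSeriesCoeff 1‖ = 1`; the value itself is inlined). [folklore] -/
theorem logSeriesCoeff_two : logSeriesCoeff 2 = -2⁻¹ := by
  norm_num [Literature.Analysis.Complex.logSeriesCoeff]

/-- `‖logSeriesCoeff 1‖ = 1`. [folklore] -/
theorem norm_logSeriesCoeff_one : ‖logSeriesCoeff 1‖ = 1 := by
  rw [norm_logSeriesCoeff_succ 0]
  norm_num

/-- `‖logSeriesCoeff 2‖ = 1/2`. [folklore] -/
theorem norm_logSeriesCoeff_two : ‖logSeriesCoeff 2‖ = 2⁻¹ := by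
  rw [logSeriesCoeff_two, norm_neg, norm_inv, Complex.norm_ofNat]

/-- **The low-order identity.**  The `n = 1, 2` part of `Σ ((−1)^{n+1}/n)((p+q+pq)^n − p^n − q^n)` is
`pq − ½((p+q+pq)² − p² − q²) = ½(pq − qp − (p²q + pqp + qpq + pq² + pqpq))` — the symmetric part of `pq` cancels
against `½(pq + qp)` (this is `½[X, Y] + O(3)` of (29)). [folklore] -/
theorem lowOrder_eq (p q : 𝔸) :
    logSeriesCoeff 1 • ((p + q + p * q) ^ 1 - p ^ 1 - q ^ 1) +
        logSeriesCoeff 2 • ((p + q + p * q) ^ 2 - p ^ 2 - q ^ 2) =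
      (2⁻¹ : ℂ) • (p * q - q * p - (p * p * q + p * q * p + q * p * q + p * q * q + p * q * p * q)) := by
  rw [mixedPow_two, logSeriesCoeff_two,
    show logSeriesCoeff 1 = 1 by norm_num [Literature.Analysis.Complex.logSeriesCoeff],
    show (p + q + p * q) ^ 1 - p ^ 1 - q ^ 1 = p * q by simp only [pow_one]; abel]
  module

/-- Norm of the low-order part: `≤ PQ + P²Q + PQ² + ½P²Q²`, which is EXACTLY `PQ` less than its term-wise majorant
`PQ + ½((P+Q+PQ)² − P² − Q²)`. [folklore] -/
theorem norm_lowOrder_le {p q : 𝔸} {P Q : ℝ} (hp : ‖p‖ ≤ P) (hq : ‖q‖ ≤ Q) :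
    ‖logSeriesCoeff 1 • ((p + q + p * q) ^ 1 - p ^ 1 - q ^ 1) +
        logSeriesCoeff 2 • ((p + q + p * q) ^ 2 - p ^ 2 - q ^ 2)‖ ≤
      P * Q + P ^ 2 * Q + P * Q ^ 2 + P ^ 2 * Q ^ 2 / 2 := by
  rw [lowOrder_eq, norm_smul, norm_inv, Complex.norm_ofNat]
  have h1 : ‖p * q‖ ≤ P * Q := norm_mul_le_of_le hp hq
  have h2 : ‖q * p‖ ≤ Q * P := norm_mul_le_of_le hq hp
  have h3 : ‖p * p * q‖ ≤ P * P * Q := norm_mul_le_of_le (norm_mul_le_of_le hp hp) hq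
  have h4 : ‖p * q * p‖ ≤ P * Q * P := norm_mul_le_of_le h1 hp
  have h5 : ‖q * p * q‖ ≤ Q * P * Q := norm_mul_le_of_le h2 hq
  have h6 : ‖p * q * q‖ ≤ P * Q * Q := norm_mul_le_of_le h1 hq
  have h7 : ‖p * q * p * q‖ ≤ P * Q * P * Q := norm_mul_le_of_le h4 hq
  have h8 : ‖p * q - q * p - (p * p * q + p * q * p + q * p * q + p * q * q + p * q * p * q)‖ ≤
      P * Q + Q * P + (P * P * Q + P * Q * P + Q * P * Q + P * Q * Q + P * Q * P * Q) :=
    norm_sub_le_of_le (norm_sub_le_of_le h1 h2)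
      (norm_add_le_of_le (norm_add_le_of_le (norm_add_le_of_le (norm_add_le_of_le h3 h4) h5) h6) h7)
  have h9 : (0 : ℝ) ≤ 2⁻¹ := by norm_num
  calc (2⁻¹ : ℝ) * ‖p * q - q * p - (p * p * q + p * q * p + q * p * q + p * q * q + p * q * p * q)‖
      ≤ 2⁻¹ * (P * Q + Q * P + (P * P * Q + P * Q * P + Q * P * Q + P * Q * Q + P * Q * P * Q)) :=
        mul_le_mul_of_nonneg_left h8 h9
    _ = _ := by ring

end LowOrder

/-! ## §3  The real majorant series `Σ_{n≥1} t^n/n = −ln(1 − t)` and its closed-form bound -/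

section Majorant

/-- `Σ_n ‖logSeriesCoeff n‖ t^n = −ln(1 − t)` for `0 ≤ t < 1` (the first majorant of (26), as a `HasSum` from `n = 0`,
the `n = 0` term being `0`). [folklore] -/
theorem hasSum_norm_logSeriesCoeff_mul_pow {t : ℝ} (h0 : 0 ≤ t) (h1 : t < 1) :
    HasSum (fun n : ℕ => ‖logSeriesCoeff n‖ * t ^ n) (-Real.log (1 - t)) := by
  have h := Real.hasSum_pow_div_log_of_abs_lt_one (x := t) (by rwa [abs_of_nonneg h0])
  rw [← hasSum_nat_add_iff' 1]
  simp only [sum_range_one, pow_zero, logSeriesCoeff_zero, norm_zero, zero_mul, sub_zero]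
  exact h.congr_fun fun n => by rw [norm_logSeriesCoeff_succ]; ring

/-- The closed form of the majorant: for `0 ≤ P, Q` and `S = P + Q + PQ < 1`,
`−ln(1 − S) + ln(1 − P) + ln(1 − Q) = ln((1 − P)(1 − Q)/(1 − S)) ≤ (1 − P)(1 − Q)/(1 − S) − 1 = 2PQ/(1 − S)`
(`(1 − P)(1 − Q) = (1 − S) + 2PQ`, `ln y ≤ y − 1`). [folklore] -/
theorem majorant_closed_form_le {P Q : ℝ} (hP : 0 ≤ P) (hQ : 0 ≤ Q) (hS : P + Q + P * Q < 1) :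
    -Real.log (1 - (P + Q + P * Q)) + Real.log (1 - P) + Real.log (1 - Q) ≤
      2 * P * Q / (1 - (P + Q + P * Q)) := by
  have hS' : 0 < 1 - (P + Q + P * Q) := by linarith
  have hP' : 0 < 1 - P := by nlinarith
  have hQ' : 0 < 1 - Q := by nlinarith
  have hy : 0 < (1 - P) * (1 - Q) / (1 - (P + Q + P * Q)) := by positivity
  have hlog : Real.log ((1 - P) * (1 - Q) / (1 - (P + Q + P * Q))) =
      -Real.log (1 - (P + Q + P * Q)) + Real.log (1 - P) + Real.log (1 - Q) := by
    rw [Real.log_div (mul_pos hP' hQ').ne' hS'.ne', Real.log_mul hP'.ne' hQ'.ne']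
    ring
  have h := Real.log_le_sub_one_of_pos hy
  rw [hlog] at h
  have hid : (1 - P) * (1 - Q) / (1 - (P + Q + P * Q)) - 1 = 2 * P * Q / (1 - (P + Q + P * Q)) := by
    field_simp
    ring
  linarith [hid]

/-- `2PQ/(1 − S) − PQ = PQ(1 + S)/(1 − S)`. [folklore] -/
theorem majorant_sub_eq {P Q : ℝ} (hS : P + Q + P * Q < 1) :
    2 * P * Q / (1 - (P + Q + P * Q)) - P * Q =
      P * Q * (1 + (P + Q + P * Q)) / (1 - (P + Q + P * Q)) := by
  have hS' : (1 - (P + Q + P * Q)) ≠ 0 := by intro h; linarith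
  field_simp
  ring

end Majorant

/-! ## §4  Assembly: `log (e^X e^Y) − X − Y` as a series in the mixed words, and its norm -/

section Assembly

variable {𝔸 : Type*} [NormedRing 𝔸] [NormedAlgebra ℂ 𝔸] [CompleteSpace 𝔸]

omit [NormedAlgebra ℂ 𝔸] [CompleteSpace 𝔸] in
/-- `e^X e^Y − 1 = p + q + pq` with `p = e^X − 1`, `q = e^Y − 1`. [folklore] -/
theorem exp_mul_exp_sub_one (X Y : 𝔸) :
    exp X * exp Y - 1 = (exp X - 1) + (exp Y - 1) + (exp X - 1) * (exp Y - 1) := by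
  noncomm_ring

/-- **The series.**  For `‖X‖, ‖Y‖ < ln 2` and `‖e^X e^Y − 1‖ < 1`:
`log (e^X e^Y) − X − Y = Σ_n logSeriesCoeff n • ((p + q + pq)^n − p^n − q^n)` (three instances of (21), with
`log e^X = X`, `log e^Y = Y` by `B7BlockAvgLog.mlog_exp`). [cite: Balaban1985Averaging, (21)/(28) pp.21–22] -/
theorem hasSum_bch_sub {X Y : 𝔸} (hX : ‖X‖ < Real.log 2) (hY : ‖Y‖ < Real.log 2)
    (hXY : ‖exp X * exp Y - 1‖ < 1) :
    HasSum (fun n : ℕ => logSeriesCoeff n •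
        (((exp X - 1) + (exp Y - 1) + (exp X - 1) * (exp Y - 1)) ^ n - (exp X - 1) ^ n - (exp Y - 1) ^ n))
      (mlog (exp X * exp Y) - X - Y) := by
  have h2 : Real.exp (Real.log 2) = 2 := Real.exp_log two_pos
  have hpX : ‖exp X - 1‖ < 1 := by
    have h := Literature.Analysis.Calculus.norm_exp_sub_one_le X
    have h' : Real.exp ‖X‖ < Real.exp (Real.log 2) := Real.exp_lt_exp.mpr hX
    linarith
  have hpY : ‖exp Y - 1‖ < 1 := by
    have h := Literature.Analysis.Calculus.norm_exp_sub_one_le Y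
    have h' : Real.exp ‖Y‖ < Real.exp (Real.log 2) := Real.exp_lt_exp.mpr hY
    linarith
  have hZ := hasSum_mlog hXY
  have hXs := hasSum_mlog hpX
  have hYs := hasSum_mlog hpY
  rw [mlog_exp hX] at hXs
  rw [mlog_exp hY] at hYs
  rw [exp_mul_exp_sub_one] at hZ
  exact ((hZ.sub hXs).sub hYs).congr_fun fun n => by simp only [smul_sub]

/-- **The abstract bound.**  If `‖e^X − 1‖ ≤ P`, `‖e^Y − 1‖ ≤ Q`, `S = P + Q + PQ < 1` and `‖X‖, ‖Y‖ < ln 2`, then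
`‖log (e^X e^Y) − X − Y‖ ≤ ln(1 + 2PQ/(1 − S)) − PQ`, written as `−ln(1 − S) + ln(1 − P) + ln(1 − Q) − PQ`.
[cite: Balaban1985Averaging, (31) p.22] -/
theorem norm_bch_sub_le_log {X Y : 𝔸} {P Q : ℝ} (hP : ‖exp X - 1‖ ≤ P) (hQ : ‖exp Y - 1‖ ≤ Q)
    (hS : P + Q + P * Q < 1) (hX : ‖X‖ < Real.log 2) (hY : ‖Y‖ < Real.log 2) :
    ‖mlog (exp X * exp Y) - X - Y‖ ≤
      -Real.log (1 - (P + Q + P * Q)) + Real.log (1 - P) + Real.log (1 - Q) - P * Q := by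
  have hP0 : 0 ≤ P := (norm_nonneg _).trans hP
  have hQ0 : 0 ≤ Q := (norm_nonneg _).trans hQ
  have hP1 : P < 1 := by nlinarith
  have hQ1 : Q < 1 := by nlinarith
  have hS0 : 0 ≤ P + Q + P * Q := by positivity
  set p := exp X - 1 with hp_def
  set q := exp Y - 1 with hq_def
  have hXY : ‖exp X * exp Y - 1‖ < 1 := by
    rw [exp_mul_exp_sub_one]
    exact (norm_add₃_le.trans (by linarith [norm_mul_le_of_le hP hQ])).trans_lt hS
  -- the series for `F` and for its majorant
  have hF : HasSum (fun n : ℕ => logSeriesCoeff n • ((p + q + p * q) ^ n - p ^ n - q ^ n))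
      (mlog (exp X * exp Y) - X - Y) := hasSum_bch_sub hX hY hXY
  have hG : HasSum (fun n : ℕ => ‖logSeriesCoeff n‖ * ((P + Q + P * Q) ^ n - P ^ n - Q ^ n))
      (-Real.log (1 - (P + Q + P * Q)) - -Real.log (1 - P) - -Real.log (1 - Q)) :=
    (((hasSum_norm_logSeriesCoeff_mul_pow hS0 hS).sub (hasSum_norm_logSeriesCoeff_mul_pow hP0 hP1)).sub
      (hasSum_norm_logSeriesCoeff_mul_pow hQ0 hQ1)).congr_fun fun n => by ring
  -- tails from `n = 3` on, dominated term-wise by the word majorant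
  have hF3 := (hasSum_nat_add_iff' 3).mpr hF
  have hG3 := (hasSum_nat_add_iff' 3).mpr hG
  have htail := hF3.norm_le_of_bounded hG3 fun n => by
    rw [norm_smul]
    exact mul_le_mul_of_nonneg_left (norm_mixedPow_le hP hQ (n + 2)) (norm_nonneg _)
  -- the first three terms (`n = 0` vanishes)
  have hf3 : ∑ i ∈ range 3, logSeriesCoeff i • ((p + q + p * q) ^ i - p ^ i - q ^ i) =
      logSeriesCoeff 1 • ((p + q + p * q) ^ 1 - p ^ 1 - q ^ 1) +
        logSeriesCoeff 2 • ((p + q + p * q) ^ 2 - p ^ 2 - q ^ 2) := by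
    rw [sum_range_succ, sum_range_succ, sum_range_one, logSeriesCoeff_zero, zero_smul, zero_add]
  have hg3 : ∑ i ∈ range 3, ‖logSeriesCoeff i‖ * ((P + Q + P * Q) ^ i - P ^ i - Q ^ i) =
      P * Q + (P * Q + P ^ 2 * Q + P * Q ^ 2 + P ^ 2 * Q ^ 2 / 2) := by
    rw [sum_range_succ, sum_range_succ, sum_range_one, logSeriesCoeff_zero, norm_zero, zero_mul, zero_add,
      norm_logSeriesCoeff_one, norm_logSeriesCoeff_two]
    ring
  have hlow := norm_lowOrder_le (p := p) (q := q) hP hQ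
  rw [← hf3] at hlow
  rw [hg3] at htail
  have hsplit : mlog (exp X * exp Y) - X - Y =
      ∑ i ∈ range 3, logSeriesCoeff i • ((p + q + p * q) ^ i - p ^ i - q ^ i) +
        (mlog (exp X * exp Y) - X - Y - ∑ i ∈ range 3, logSeriesCoeff i • ((p + q + p * q) ^ i - p ^ i - q ^ i)) := by
    rw [add_sub_cancel]
  calc ‖mlog (exp X * exp Y) - X - Y‖
      ≤ ‖∑ i ∈ range 3, logSeriesCoeff i • ((p + q + p * q) ^ i - p ^ i - q ^ i)‖ +
          ‖mlog (exp X * exp Y) - X - Y - ∑ i ∈ range 3, logSeriesCoeff i • ((p + q + p * q) ^ i - p ^ i - q ^ i)‖ := by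
        rw [hsplit, add_sub_cancel_left]
        exact norm_add_le _ _
    _ ≤ _ := by linarith

/-- **The abstract bound, rational form**: under the same hypotheses,
`‖log (e^X e^Y) − X − Y‖ ≤ PQ(1 + S)/(1 − S)`, `S = P + Q + PQ`. [cite: Balaban1985Averaging, (31) p.22] -/
theorem norm_bch_sub_le {X Y : 𝔸} {P Q : ℝ} (hP : ‖exp X - 1‖ ≤ P) (hQ : ‖exp Y - 1‖ ≤ Q)
    (hS : P + Q + P * Q < 1) (hX : ‖X‖ < Real.log 2) (hY : ‖Y‖ < Real.log 2) :
    ‖mlog (exp X * exp Y) - X - Y‖ ≤ P * Q * (1 + (P + Q + P * Q)) / (1 - (P + Q + P * Q)) := by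
  have hP0 : 0 ≤ P := (norm_nonneg _).trans hP
  have hQ0 : 0 ≤ Q := (norm_nonneg _).trans hQ
  have h1 := norm_bch_sub_le_log hP hQ hS hX hY
  have h2 := majorant_closed_form_le hP0 hQ0 hS
  rw [← majorant_sub_eq hS]
  linarith

/-- **The bound in terms of `a = ‖X‖`, `b = ‖Y‖`** on the polydisc `a + b < ln 2`:
`‖log (e^X e^Y) − X − Y‖ ≤ (e^a − 1)(e^b − 1)·e^{a+b}/(2 − e^{a+b})` (`P = e^a − 1`, `Q = e^b − 1`, `1 + S = e^{a+b}`).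
[cite: Balaban1985Averaging, (31) p.22] -/
theorem norm_bch_sub_le_of_norm_add_lt {X Y : 𝔸} (h : ‖X‖ + ‖Y‖ < Real.log 2) :
    ‖mlog (exp X * exp Y) - X - Y‖ ≤
      (Real.exp ‖X‖ - 1) * (Real.exp ‖Y‖ - 1) * Real.exp (‖X‖ + ‖Y‖) / (2 - Real.exp (‖X‖ + ‖Y‖)) := by
  have hX : ‖X‖ < Real.log 2 := by linarith [norm_nonneg Y]
  have hY : ‖Y‖ < Real.log 2 := by linarith [norm_nonneg X]
  have h2 : Real.exp (‖X‖ + ‖Y‖) < 2 := by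
    calc Real.exp (‖X‖ + ‖Y‖) < Real.exp (Real.log 2) := Real.exp_lt_exp.mpr h
      _ = 2 := Real.exp_log two_pos
  have hP := Literature.Analysis.Calculus.norm_exp_sub_one_le X
  have hQ := Literature.Analysis.Calculus.norm_exp_sub_one_le Y
  have hmul : Real.exp (‖X‖ + ‖Y‖) = Real.exp ‖X‖ * Real.exp ‖Y‖ := Real.exp_add _ _
  have hS : (Real.exp ‖X‖ - 1) + (Real.exp ‖Y‖ - 1) + (Real.exp ‖X‖ - 1) * (Real.exp ‖Y‖ - 1) < 1 := by
    nlinarith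
  have h1 := norm_bch_sub_le hP hQ hS hX hY
  have hid1 : 1 + ((Real.exp ‖X‖ - 1) + (Real.exp ‖Y‖ - 1) + (Real.exp ‖X‖ - 1) * (Real.exp ‖Y‖ - 1)) =
      Real.exp (‖X‖ + ‖Y‖) := by rw [hmul]; ring
  have hid2 : 1 - ((Real.exp ‖X‖ - 1) + (Real.exp ‖Y‖ - 1) + (Real.exp ‖X‖ - 1) * (Real.exp ‖Y‖ - 1)) =
      2 - Real.exp (‖X‖ + ‖Y‖) := by rw [hmul]; ring
  rwa [hid1, hid2] at h1

end Assembly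

/-! ## §5  The printed (31) with the explicit admissible constant `c₁ = 1/10` -/

section Printed

variable {𝔸 : Type*} [NormedRing 𝔸] [NormedAlgebra ℂ 𝔸] [CompleteSpace 𝔸]

/-- `e^{1/5} ≤ 11/9` (`e^{1/5} = 1.2214…`, `11/9 = 1.2222…`). [folklore] -/
theorem exp_one_fifth_le : Real.exp (1 / 5) ≤ 11 / 9 := by
  have h := exp_le_quartic (x := 1 / 5) (by norm_num) (by norm_num)
  have h2 : (1 : ℝ) + 1 / 5 + (1 / 5) ^ 2 / 2 + (1 / 5) ^ 3 / 6 + 5 * (1 / 5) ^ 4 / 96 ≤ 11 / 9 := by norm_num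
  exact h.trans h2

/-- **(31), kernel form on `‖X‖ + ‖Y‖ ≤ 1/5`**: `‖log (e^X e^Y) − X − Y‖ ≤ 2‖X‖‖Y‖`.  (With `E = e^{a+b} ≤ e^{1/5} ≤ 11/9`:
the bound of `norm_bch_sub_le_of_norm_add_lt` is `≤ ab·E²/(2 − E) ≤ ab·121/63 ≤ 2ab`.)
[cite: Balaban1985Averaging, (31) p.22] -/
theorem eq31_of_sum_le {X Y : 𝔸} (h : ‖X‖ + ‖Y‖ ≤ 1 / 5) :
    ‖mlog (exp X * exp Y) - X - Y‖ ≤ 2 * ‖X‖ * ‖Y‖ := by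
  have hlog2 : (1 : ℝ) / 5 < Real.log 2 := by
    rw [Real.lt_log_iff_exp_lt two_pos]
    linarith [exp_one_fifth_le]
  have h0 := norm_bch_sub_le_of_norm_add_lt (X := X) (Y := Y) (by linarith)
  set a := ‖X‖ with ha_def
  set b := ‖Y‖ with hb_def
  have ha : 0 ≤ a := norm_nonneg X
  have hb : 0 ≤ b := norm_nonneg Y
  set E := Real.exp (a + b) with hE_def
  have hE1 : 1 ≤ E := by rw [hE_def]; exact Real.one_le_exp (by positivity)
  have hE2 : E ≤ 11 / 9 := (Real.exp_le_exp.mpr h).trans exp_one_fifth_le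
  have hP0 : 0 ≤ Real.exp a - 1 := by linarith [Real.one_le_exp ha]
  have hQ0 : 0 ≤ Real.exp b - 1 := by linarith [Real.one_le_exp hb]
  have hPQ : (Real.exp a - 1) * (Real.exp b - 1) ≤ a * b * E := by
    calc (Real.exp a - 1) * (Real.exp b - 1) ≤ (a * Real.exp a) * (b * Real.exp b) :=
          mul_le_mul (AreaLaw.exp_sub_one_le_mul_exp a) (AreaLaw.exp_sub_one_le_mul_exp b) hQ0 (by positivity)
      _ = a * b * E := by rw [hE_def, Real.exp_add]; ring
  have hden : 0 < 2 - E := by linarith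
  have h1 : (Real.exp a - 1) * (Real.exp b - 1) * E / (2 - E) ≤ a * b * E * E / (2 - E) := by
    gcongr
  have h2 : a * b * E * E / (2 - E) ≤ 2 * a * b := by
    rw [div_le_iff₀ hden]
    have hab : 0 ≤ a * b := mul_nonneg ha hb
    have hE3 : 0 ≤ 2 * (2 - E) - E * E := by
      nlinarith [mul_nonneg (sub_nonneg.mpr hE2) (by linarith : (0 : ℝ) ≤ E + 29 / 9)]
    nlinarith [mul_nonneg hab hE3]
  linarith

/-- **(31) as printed, with `c₁ = 1/10`**: "`|Z − X − Y| ≤ 2|X||Y|` for `|X|, |Y| ≤ c₁`", `Z = log e^X e^Y`,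
kernel-checked for `c₁ = 1/10` (`log` = the series (21), `𝔸` any complete normed `ℂ`-algebra).
[cite: Balaban1985Averaging, (31) p.22] -/
theorem eq31_printed {X Y : 𝔸} (hX : ‖X‖ ≤ 1 / 10) (hY : ‖Y‖ ≤ 1 / 10) :
    ‖mlog (exp X * exp Y) - X - Y‖ ≤ 2 * ‖X‖ * ‖Y‖ :=
  eq31_of_sum_le (by linarith)

end Printed

/-! ## §6  (v1.1) The printed (30) with an explicit `O(1)`: `|Z − X − Y − ½[X, Y]| ≤ 5(|X|²|Y| + |X||Y|²)` -/

section Commutator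

variable {𝔸 : Type*} [NormedRing 𝔸]

/-- `[X + r, Y + s] − [X, Y] = [X, s] + [r, Y] + [r, s]` (used with `r = e^X − 1 − X`, `s = e^Y − 1 − Y`). [folklore] -/
theorem comm_add_sub_comm (X Y r s : 𝔸) :
    (X + r) * (Y + s) - (Y + s) * (X + r) - (X * Y - Y * X) =
      (X * s - s * X) + (r * Y - Y * r) + (r * s - s * r) := by
  noncomm_ring

/-- `‖[X + r, Y + s] − [X, Y]‖ ≤ 2(‖X‖‖s‖ + ‖Y‖‖r‖ + ‖r‖‖s‖)`. [folklore] -/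
theorem norm_comm_add_sub_comm_le (X Y r s : 𝔸) :
    ‖(X + r) * (Y + s) - (Y + s) * (X + r) - (X * Y - Y * X)‖ ≤ 2 * (‖X‖ * ‖s‖ + ‖Y‖ * ‖r‖ + ‖r‖ * ‖s‖) := by
  rw [comm_add_sub_comm]
  have h1 : ‖X * s - s * X‖ ≤ ‖X‖ * ‖s‖ + ‖s‖ * ‖X‖ :=
    (norm_sub_le _ _).trans (add_le_add (norm_mul_le _ _) (norm_mul_le _ _))
  have h2 : ‖r * Y - Y * r‖ ≤ ‖r‖ * ‖Y‖ + ‖Y‖ * ‖r‖ :=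
    (norm_sub_le _ _).trans (add_le_add (norm_mul_le _ _) (norm_mul_le _ _))
  have h3 : ‖r * s - s * r‖ ≤ ‖r‖ * ‖s‖ + ‖s‖ * ‖r‖ :=
    (norm_sub_le _ _).trans (add_le_add (norm_mul_le _ _) (norm_mul_le _ _))
  calc ‖X * s - s * X + (r * Y - Y * r) + (r * s - s * r)‖
      ≤ ‖X * s - s * X‖ + ‖r * Y - Y * r‖ + ‖r * s - s * r‖ := norm_add₃_le
    _ ≤ _ := by nlinarith [norm_nonneg X, norm_nonneg Y, norm_nonneg r, norm_nonneg s]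

end Commutator

section LowOrderComm

variable {𝔸 : Type*} [NormedRing 𝔸] [NormedAlgebra ℂ 𝔸]

/-- The `n = 1, 2` part minus the printed `½[X, Y]`:
`c₁•D₁ + c₂•D₂ − ½(XY − YX) = ½((pq − qp) − (XY − YX)) − ½(p²q + pqp + qpq + pq² + pqpq)`. [folklore] -/
theorem lowOrder_sub_comm_eq (p q X Y : 𝔸) :
    logSeriesCoeff 1 • ((p + q + p * q) ^ 1 - p ^ 1 - q ^ 1) +
        logSeriesCoeff 2 • ((p + q + p * q) ^ 2 - p ^ 2 - q ^ 2) - (2⁻¹ : ℂ) • (X * Y - Y * X) =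
      (2⁻¹ : ℂ) • ((p * q - q * p) - (X * Y - Y * X)) -
        (2⁻¹ : ℂ) • (p * p * q + p * q * p + q * p * q + p * q * q + p * q * p * q) := by
  rw [lowOrder_eq]
  module

/-- Norm of the `n = 1, 2` part minus `½[X, Y]`, with `p = X + r`, `q = Y + s`:
`≤ (‖X‖‖s‖ + ‖Y‖‖r‖ + ‖r‖‖s‖) + (P²Q + PQ² + ½P²Q²)`. [folklore] -/
theorem norm_lowOrder_sub_comm_le {X Y r s : 𝔸} {P Q : ℝ} (hP : ‖X + r‖ ≤ P) (hQ : ‖Y + s‖ ≤ Q) :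
    ‖logSeriesCoeff 1 • (((X + r) + (Y + s) + (X + r) * (Y + s)) ^ 1 - (X + r) ^ 1 - (Y + s) ^ 1) +
        logSeriesCoeff 2 • (((X + r) + (Y + s) + (X + r) * (Y + s)) ^ 2 - (X + r) ^ 2 - (Y + s) ^ 2) -
          (2⁻¹ : ℂ) • (X * Y - Y * X)‖ ≤
      (‖X‖ * ‖s‖ + ‖Y‖ * ‖r‖ + ‖r‖ * ‖s‖) + (P ^ 2 * Q + P * Q ^ 2 + P ^ 2 * Q ^ 2 / 2) := by
  set p := X + r with hp
  set q := Y + s with hq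
  have hP0 : 0 ≤ P := (norm_nonneg _).trans hP
  have hQ0 : 0 ≤ Q := (norm_nonneg _).trans hQ
  rw [lowOrder_sub_comm_eq]
  have h2 : ‖(2⁻¹ : ℂ)‖ = 2⁻¹ := by simp
  have hc : ‖(2⁻¹ : ℂ) • ((p * q - q * p) - (X * Y - Y * X))‖ ≤ ‖X‖ * ‖s‖ + ‖Y‖ * ‖r‖ + ‖r‖ * ‖s‖ := by
    rw [norm_smul, h2, hp, hq]
    have h := norm_comm_add_sub_comm_le X Y r s
    linarith
  have hw : ‖(2⁻¹ : ℂ) • (p * p * q + p * q * p + q * p * q + p * q * q + p * q * p * q)‖ ≤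
      P ^ 2 * Q + P * Q ^ 2 + P ^ 2 * Q ^ 2 / 2 := by
    rw [norm_smul, h2]
    have hppq : ‖p * p * q‖ ≤ P * P * Q := norm_mul₃_le.trans (by gcongr)
    have hpqp : ‖p * q * p‖ ≤ P * Q * P := norm_mul₃_le.trans (by gcongr)
    have hqpq : ‖q * p * q‖ ≤ Q * P * Q := norm_mul₃_le.trans (by gcongr)
    have hpqq : ‖p * q * q‖ ≤ P * Q * Q := norm_mul₃_le.trans (by gcongr)
    have hpqpq : ‖p * q * p * q‖ ≤ P * Q * P * Q :=
      (norm_mul_le _ _).trans (mul_le_mul hpqp hQ (norm_nonneg _) (by positivity))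
    have hsum : ‖p * p * q + p * q * p + q * p * q + p * q * q + p * q * p * q‖ ≤
        P * P * Q + P * Q * P + Q * P * Q + P * Q * Q + P * Q * P * Q :=
      (norm_add_le _ _).trans (add_le_add ((norm_add_le _ _).trans (add_le_add ((norm_add_le _ _).trans
        (add_le_add ((norm_add_le _ _).trans (add_le_add hppq hpqp)) hqpq)) hpqq)) hpqpq)
    nlinarith
  exact (norm_sub_le _ _).trans (add_le_add hc hw)

end LowOrderComm

section Thirty

variable {𝔸 : Type*} [NormedRing 𝔸] [NormedAlgebra ℂ 𝔸] [CompleteSpace 𝔸]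

/-- **(30), abstract form.**  If `‖e^X − 1‖ ≤ P`, `‖e^Y − 1‖ ≤ Q`, `S = P + Q + PQ < 1`, `‖X‖, ‖Y‖ < ln 2`, and
`‖e^X − 1 − X‖ ≤ ρ`, `‖e^Y − 1 − Y‖ ≤ σ`, then
`‖log (e^X e^Y) − X − Y − ½(XY − YX)‖ ≤ (−ln(1 − S) + ln(1 − P) + ln(1 − Q) − 2PQ) + (‖X‖σ + ‖Y‖ρ + ρσ)`:
the tail `n ≥ 3` of the series of `hasSum_bch_sub` is bounded by its majorant, the words `n = 1, 2` are exact
(`lowOrder_sub_comm_eq`), and `½([e^X − 1, e^Y − 1] − [X, Y]) = ½([X, s] + [r, Y] + [r, s])`, `r = e^X − 1 − X`,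
`s = e^Y − 1 − Y`. [cite: Balaban1985Averaging, (30) p.22] -/
theorem norm_bch_sub_comm_le_log {X Y : 𝔸} {P Q ρ σ : ℝ} (hP : ‖exp X - 1‖ ≤ P) (hQ : ‖exp Y - 1‖ ≤ Q)
    (hS : P + Q + P * Q < 1) (hX : ‖X‖ < Real.log 2) (hY : ‖Y‖ < Real.log 2)
    (hρ : ‖exp X - 1 - X‖ ≤ ρ) (hσ : ‖exp Y - 1 - Y‖ ≤ σ) :
    ‖mlog (exp X * exp Y) - X - Y - (2⁻¹ : ℂ) • (X * Y - Y * X)‖ ≤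
      (-Real.log (1 - (P + Q + P * Q)) + Real.log (1 - P) + Real.log (1 - Q) - 2 * (P * Q)) +
        (‖X‖ * σ + ‖Y‖ * ρ + ρ * σ) := by
  have hP0 : 0 ≤ P := (norm_nonneg _).trans hP
  have hQ0 : 0 ≤ Q := (norm_nonneg _).trans hQ
  have hρ0 : 0 ≤ ρ := (norm_nonneg _).trans hρ
  have hσ0 : 0 ≤ σ := (norm_nonneg _).trans hσ
  have hP1 : P < 1 := by nlinarith
  have hQ1 : Q < 1 := by nlinarith
  have hS0 : 0 ≤ P + Q + P * Q := by positivity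
  set p := exp X - 1 with hp_def
  set q := exp Y - 1 with hq_def
  have hXY : ‖exp X * exp Y - 1‖ < 1 := by
    rw [exp_mul_exp_sub_one]
    exact (norm_add₃_le.trans (by linarith [norm_mul_le_of_le hP hQ])).trans_lt hS
  have hF : HasSum (fun n : ℕ => logSeriesCoeff n • ((p + q + p * q) ^ n - p ^ n - q ^ n))
      (mlog (exp X * exp Y) - X - Y) := hasSum_bch_sub hX hY hXY
  have hG : HasSum (fun n : ℕ => ‖logSeriesCoeff n‖ * ((P + Q + P * Q) ^ n - P ^ n - Q ^ n))
      (-Real.log (1 - (P + Q + P * Q)) - -Real.log (1 - P) - -Real.log (1 - Q)) :=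
    (((hasSum_norm_logSeriesCoeff_mul_pow hS0 hS).sub (hasSum_norm_logSeriesCoeff_mul_pow hP0 hP1)).sub
      (hasSum_norm_logSeriesCoeff_mul_pow hQ0 hQ1)).congr_fun fun n => by ring
  have hF3 := (hasSum_nat_add_iff' 3).mpr hF
  have hG3 := (hasSum_nat_add_iff' 3).mpr hG
  have htail := hF3.norm_le_of_bounded hG3 fun n => by
    rw [norm_smul]
    exact mul_le_mul_of_nonneg_left (norm_mixedPow_le hP hQ (n + 2)) (norm_nonneg _)
  have hf3 : ∑ i ∈ range 3, logSeriesCoeff i • ((p + q + p * q) ^ i - p ^ i - q ^ i) =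
      logSeriesCoeff 1 • ((p + q + p * q) ^ 1 - p ^ 1 - q ^ 1) +
        logSeriesCoeff 2 • ((p + q + p * q) ^ 2 - p ^ 2 - q ^ 2) := by
    rw [sum_range_succ, sum_range_succ, sum_range_one, logSeriesCoeff_zero, zero_smul, zero_add]
  have hg3 : ∑ i ∈ range 3, ‖logSeriesCoeff i‖ * ((P + Q + P * Q) ^ i - P ^ i - Q ^ i) =
      P * Q + (P * Q + P ^ 2 * Q + P * Q ^ 2 + P ^ 2 * Q ^ 2 / 2) := by
    rw [sum_range_succ, sum_range_succ, sum_range_one, logSeriesCoeff_zero, norm_zero, zero_mul, zero_add,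
      norm_logSeriesCoeff_one, norm_logSeriesCoeff_two]
    ring
  rw [hg3] at htail
  -- the low-order part minus the commutator: write `p = X + r`, `q = Y + s`
  have hpr : p = X + (exp X - 1 - X) := by rw [hp_def]; abel
  have hqs : q = Y + (exp Y - 1 - Y) := by rw [hq_def]; abel
  have hPr : ‖X + (exp X - 1 - X)‖ ≤ P := by rwa [← hpr]
  have hQs : ‖Y + (exp Y - 1 - Y)‖ ≤ Q := by rwa [← hqs]
  have hlow := norm_lowOrder_sub_comm_le (X := X) (Y := Y) hPr hQs
  rw [← hpr, ← hqs, ← hf3] at hlow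
  have hρσ : ‖X‖ * ‖exp Y - 1 - Y‖ + ‖Y‖ * ‖exp X - 1 - X‖ + ‖exp X - 1 - X‖ * ‖exp Y - 1 - Y‖ ≤
      ‖X‖ * σ + ‖Y‖ * ρ + ρ * σ := by
    have h1 := mul_le_mul_of_nonneg_left hσ (norm_nonneg X)
    have h2 := mul_le_mul_of_nonneg_left hρ (norm_nonneg Y)
    have h3 := mul_le_mul hρ hσ (norm_nonneg _) hρ0
    linarith
  have hsplit : mlog (exp X * exp Y) - X - Y - (2⁻¹ : ℂ) • (X * Y - Y * X) =
      (∑ i ∈ range 3, logSeriesCoeff i • ((p + q + p * q) ^ i - p ^ i - q ^ i) - (2⁻¹ : ℂ) • (X * Y - Y * X)) +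
        (mlog (exp X * exp Y) - X - Y - ∑ i ∈ range 3, logSeriesCoeff i • ((p + q + p * q) ^ i - p ^ i - q ^ i)) := by
    abel
  calc ‖mlog (exp X * exp Y) - X - Y - (2⁻¹ : ℂ) • (X * Y - Y * X)‖
      ≤ ‖∑ i ∈ range 3, logSeriesCoeff i • ((p + q + p * q) ^ i - p ^ i - q ^ i) - (2⁻¹ : ℂ) • (X * Y - Y * X)‖ +
          ‖mlog (exp X * exp Y) - X - Y - ∑ i ∈ range 3, logSeriesCoeff i • ((p + q + p * q) ^ i - p ^ i - q ^ i)‖ := by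
        rw [hsplit]; exact norm_add_le _ _
    _ ≤ _ := by linarith

/-- **(30), rational form**: under the same hypotheses,
`‖log (e^X e^Y) − X − Y − ½(XY − YX)‖ ≤ 2PQ·S/(1 − S) + (‖X‖σ + ‖Y‖ρ + ρσ)`, `S = P + Q + PQ`.
[cite: Balaban1985Averaging, (30) p.22] -/
theorem norm_bch_sub_comm_le {X Y : 𝔸} {P Q ρ σ : ℝ} (hP : ‖exp X - 1‖ ≤ P) (hQ : ‖exp Y - 1‖ ≤ Q)
    (hS : P + Q + P * Q < 1) (hX : ‖X‖ < Real.log 2) (hY : ‖Y‖ < Real.log 2)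
    (hρ : ‖exp X - 1 - X‖ ≤ ρ) (hσ : ‖exp Y - 1 - Y‖ ≤ σ) :
    ‖mlog (exp X * exp Y) - X - Y - (2⁻¹ : ℂ) • (X * Y - Y * X)‖ ≤
      2 * P * Q * (P + Q + P * Q) / (1 - (P + Q + P * Q)) + (‖X‖ * σ + ‖Y‖ * ρ + ρ * σ) := by
  have hP0 : 0 ≤ P := (norm_nonneg _).trans hP
  have hQ0 : 0 ≤ Q := (norm_nonneg _).trans hQ
  have h1 := norm_bch_sub_comm_le_log hP hQ hS hX hY hρ hσ
  have h2 := majorant_closed_form_le hP0 hQ0 hS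
  have hne : 1 - (P + Q + P * Q) ≠ 0 := ne_of_gt (by linarith)
  have hid : 2 * P * Q * (P + Q + P * Q) / (1 - (P + Q + P * Q)) =
      2 * P * Q / (1 - (P + Q + P * Q)) - 2 * (P * Q) := by
    rw [eq_sub_iff_add_eq, div_add' _ _ _ hne, div_eq_div_iff hne hne]
    ring
  rw [hid]
  linarith

/-- **(30) in terms of `a = ‖X‖`, `b = ‖Y‖`** on the polydisc `a + b < ln 2`:
`‖log (e^X e^Y) − X − Y − ½(XY − YX)‖ ≤ 2(e^a − 1)(e^b − 1)(e^{a+b} − 1)/(2 − e^{a+b})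
  + (a(e^b − 1 − b) + b(e^a − 1 − a) + (e^a − 1 − a)(e^b − 1 − b))`
(`‖e^X − 1 − X‖ ≤ e^a − 1 − a` is the tree's `OneLinkLaplace.norm_exp_sub_one_sub_le`, module
`TiltedExponentMorseBounds`, in the import closure via `B7BlockAvgLog`). [cite: Balaban1985Averaging, (30) p.22] -/
theorem norm_bch_sub_comm_le_of_norm_add_lt {X Y : 𝔸} (h : ‖X‖ + ‖Y‖ < Real.log 2) :
    ‖mlog (exp X * exp Y) - X - Y - (2⁻¹ : ℂ) • (X * Y - Y * X)‖ ≤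
      2 * (Real.exp ‖X‖ - 1) * (Real.exp ‖Y‖ - 1) * (Real.exp (‖X‖ + ‖Y‖) - 1) / (2 - Real.exp (‖X‖ + ‖Y‖)) +
        (‖X‖ * (Real.exp ‖Y‖ - 1 - ‖Y‖) + ‖Y‖ * (Real.exp ‖X‖ - 1 - ‖X‖) +
          (Real.exp ‖X‖ - 1 - ‖X‖) * (Real.exp ‖Y‖ - 1 - ‖Y‖)) := by
  have hX : ‖X‖ < Real.log 2 := by linarith [norm_nonneg Y]
  have hY : ‖Y‖ < Real.log 2 := by linarith [norm_nonneg X]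
  have h2 : Real.exp (‖X‖ + ‖Y‖) < 2 := by
    calc Real.exp (‖X‖ + ‖Y‖) < Real.exp (Real.log 2) := Real.exp_lt_exp.mpr h
      _ = 2 := Real.exp_log two_pos
  have hP := Literature.Analysis.Calculus.norm_exp_sub_one_le X
  have hQ := Literature.Analysis.Calculus.norm_exp_sub_one_le Y
  have hρ := OneLinkLaplace.norm_exp_sub_one_sub_le X
  have hσ := OneLinkLaplace.norm_exp_sub_one_sub_le Y
  have hmul : Real.exp (‖X‖ + ‖Y‖) = Real.exp ‖X‖ * Real.exp ‖Y‖ := Real.exp_add _ _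
  have hS : (Real.exp ‖X‖ - 1) + (Real.exp ‖Y‖ - 1) + (Real.exp ‖X‖ - 1) * (Real.exp ‖Y‖ - 1) < 1 := by
    nlinarith
  have h1 := norm_bch_sub_comm_le hP hQ hS hX hY hρ hσ
  have hid1 : (Real.exp ‖X‖ - 1) + (Real.exp ‖Y‖ - 1) + (Real.exp ‖X‖ - 1) * (Real.exp ‖Y‖ - 1) =
      Real.exp (‖X‖ + ‖Y‖) - 1 := by rw [hmul]; ring
  have hid2 : 1 - ((Real.exp ‖X‖ - 1) + (Real.exp ‖Y‖ - 1) + (Real.exp ‖X‖ - 1) * (Real.exp ‖Y‖ - 1)) =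
      2 - Real.exp (‖X‖ + ‖Y‖) := by rw [hmul]; ring
  rwa [hid2, hid1] at h1

/-- **(30) with the explicit `O(1) = 5` on `‖X‖ + ‖Y‖ ≤ 1/5`**:
`‖log (e^X e^Y) − X − Y − ½(XY − YX)‖ ≤ 5(‖X‖²‖Y‖ + ‖X‖‖Y‖²)`.  Numerical inputs: `e^{1/5} ≤ 11/9`
(`exp_one_fifth_le`), `e^t − 1 ≤ t e^t` (`AreaLaw.exp_sub_one_le_mul_exp`) and `|e^t − 1 − t| ≤ t²` for `|t| ≤ 1`
(Mathlib `Real.abs_exp_sub_one_sub_id_le`); with `E = e^{a+b} ≤ 11/9` the two pieces are at most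
`2E²/(2 − E)·ab(a + b) ≤ (242/63)·ab(a + b)` and `ab(a + b) + a²b² ≤ (21/20)·ab(a + b)`, total `< 4.9·ab(a + b)`.
[cite: Balaban1985Averaging, (30) p.22] -/
theorem eq30_of_sum_le {X Y : 𝔸} (h : ‖X‖ + ‖Y‖ ≤ 1 / 5) :
    ‖mlog (exp X * exp Y) - X - Y - (2⁻¹ : ℂ) • (X * Y - Y * X)‖ ≤ 5 * (‖X‖ ^ 2 * ‖Y‖ + ‖X‖ * ‖Y‖ ^ 2) := by
  have hlog2 : (1 : ℝ) / 5 < Real.log 2 := by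
    rw [Real.lt_log_iff_exp_lt two_pos]
    linarith [exp_one_fifth_le]
  have hmain := norm_bch_sub_comm_le_of_norm_add_lt (X := X) (Y := Y) (by linarith)
  set a := ‖X‖ with ha
  set b := ‖Y‖ with hb
  have ha0 : 0 ≤ a := norm_nonneg _
  have hb0 : 0 ≤ b := norm_nonneg _
  -- the elementary real inputs
  set E := Real.exp (a + b) with hE
  have hEab : E = Real.exp a * Real.exp b := Real.exp_add _ _
  have hE1 : 1 ≤ E := Real.one_le_exp (by positivity)
  have hE119 : E ≤ 11 / 9 := (Real.exp_le_exp.mpr h).trans exp_one_fifth_le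
  have hea1 : 1 ≤ Real.exp a := Real.one_le_exp ha0
  have heb1 : 1 ≤ Real.exp b := Real.one_le_exp hb0
  have hPa : Real.exp a - 1 ≤ a * Real.exp a := AreaLaw.exp_sub_one_le_mul_exp a
  have hQb : Real.exp b - 1 ≤ b * Real.exp b := AreaLaw.exp_sub_one_le_mul_exp b
  have hSab : E - 1 ≤ (a + b) * E := by rw [hE]; exact AreaLaw.exp_sub_one_le_mul_exp (a + b)
  have hρa : Real.exp a - 1 - a ≤ a ^ 2 := by
    have h' := Real.abs_exp_sub_one_sub_id_le (x := a) (by rw [abs_of_nonneg ha0]; linarith)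
    exact (le_abs_self _).trans h'
  have hσb : Real.exp b - 1 - b ≤ b ^ 2 := by
    have h' := Real.abs_exp_sub_one_sub_id_le (x := b) (by rw [abs_of_nonneg hb0]; linarith)
    exact (le_abs_self _).trans h'
  have hρa0 : 0 ≤ Real.exp a - 1 - a := by linarith [Real.add_one_le_exp a]
  have hσb0 : 0 ≤ Real.exp b - 1 - b := by linarith [Real.add_one_le_exp b]
  have habE : 0 ≤ a * b * (a + b) := by positivity
  -- piece 1: the tail/majorant term `2PQ·S/(1 − S) ≤ 2E²/(2 − E)·ab(a + b) ≤ (242/63)·ab(a + b)`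
  have hPQ : (Real.exp a - 1) * (Real.exp b - 1) ≤ a * b * E := by
    rw [hEab]
    calc (Real.exp a - 1) * (Real.exp b - 1) ≤ (a * Real.exp a) * (b * Real.exp b) :=
          mul_le_mul hPa hQb (by linarith) (by positivity)
      _ = a * b * (Real.exp a * Real.exp b) := by ring
  have hden : 0 < 2 - E := by linarith
  have hquad : 2 * E * E ≤ 242 / 63 * (2 - E) := by
    have hq : 0 ≤ (E + 22 / 7) * (11 / 9 - E) := mul_nonneg (by linarith) (by linarith)
    linear_combination 2 * hq
  have hpiece1 : 2 * (Real.exp a - 1) * (Real.exp b - 1) * (E - 1) / (2 - E) ≤ 242 / 63 * (a * b * (a + b)) := by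
    rw [div_le_iff₀ hden]
    have habE0 : 0 ≤ 2 * (a * b * E) := by positivity
    have hnum : 2 * ((Real.exp a - 1) * (Real.exp b - 1)) * (E - 1) ≤ 2 * (a * b * E) * ((a + b) * E) :=
      mul_le_mul (mul_le_mul_of_nonneg_left hPQ (by norm_num)) hSab (by linarith) habE0
    calc 2 * (Real.exp a - 1) * (Real.exp b - 1) * (E - 1)
        = 2 * ((Real.exp a - 1) * (Real.exp b - 1)) * (E - 1) := by ring
      _ ≤ 2 * (a * b * E) * ((a + b) * E) := hnum
      _ = 2 * E * E * (a * b * (a + b)) := by ring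
      _ ≤ 242 / 63 * (2 - E) * (a * b * (a + b)) := mul_le_mul_of_nonneg_right hquad habE
      _ = 242 / 63 * (a * b * (a + b)) * (2 - E) := by ring
  -- piece 2: the commutator-correction term `aσ + bρ + ρσ ≤ ab² + a²b + a²b² ≤ (21/20)·ab(a + b)`
  have hab4 : a * b ≤ (a + b) / 20 := by
    nlinarith [sq_nonneg (a - b), mul_nonneg (add_nonneg ha0 hb0) (show 0 ≤ 1 / 5 - (a + b) by linarith)]
  have hpiece2 : a * (Real.exp b - 1 - b) + b * (Real.exp a - 1 - a) + (Real.exp a - 1 - a) * (Real.exp b - 1 - b) ≤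
      21 / 20 * (a * b * (a + b)) := by
    have h1 : a * (Real.exp b - 1 - b) ≤ a * b ^ 2 := mul_le_mul_of_nonneg_left hσb ha0
    have h2 : b * (Real.exp a - 1 - a) ≤ b * a ^ 2 := mul_le_mul_of_nonneg_left hρa hb0
    have h3 : (Real.exp a - 1 - a) * (Real.exp b - 1 - b) ≤ a ^ 2 * b ^ 2 :=
      mul_le_mul hρa hσb hσb0 (by positivity)
    have h4 : a ^ 2 * b ^ 2 ≤ (a * b) * ((a + b) / 20) := by
      rw [show a ^ 2 * b ^ 2 = (a * b) * (a * b) by ring]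
      exact mul_le_mul_of_nonneg_left hab4 (by positivity)
    linarith
  have hfin : 242 / 63 * (a * b * (a + b)) + 21 / 20 * (a * b * (a + b)) ≤ 5 * (a ^ 2 * b + a * b ^ 2) := by
    rw [show a ^ 2 * b + a * b ^ 2 = a * b * (a + b) by ring]
    linarith
  linarith

/-- **Bałaban's (30), p. 22, with the explicit constant `O(1) = 5` for `|X|, |Y| ≤ 1/10`:**
`|log e^X e^Y − X − Y − ½[X, Y]| ≤ 5(|X|²|Y| + |X||Y|²)`, `[X, Y] = XY − YX`, `log` = the series (21).
[cite: Balaban1985Averaging, (30) p.22] -/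
theorem eq30_printed {X Y : 𝔸} (hX : ‖X‖ ≤ 1 / 10) (hY : ‖Y‖ ≤ 1 / 10) :
    ‖mlog (exp X * exp Y) - X - Y - (2⁻¹ : ℂ) • (X * Y - Y * X)‖ ≤ 5 * (‖X‖ ^ 2 * ‖Y‖ + ‖X‖ * ‖Y‖ ^ 2) :=
  eq30_of_sum_le (by linarith)

end Thirty

end Literature.MathematicalPhysics.QuantumFieldTheory.Balaban1983to89.B7Eq31BCH
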